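import Mathlib.NumberTheory.NumberField.Cyclotomic.PID
import Mathlib.NumberTheory.NumberField.Cyclotomic.Ideal
import Mathlib.Analysis.Real.Pi.Bounds
import Mathlib.RingTheory.ZMod
import Mathlib.Tactic.NormNum.Prime
import HarnessLib

/-!
# `ℚ(ζ₁₁)` has class number one: `ℤ[ζ₁₁]` is a principal ideal domain

Topic `Literature/NumberTheory/NumberFields`, namespace `Literature.NumberTheory.NumberFields`.  Theorems only;
no definition, no named fact (net Literature debt 0).  Companion of `CyclotomicFieldsSevenNineClassNumber` (the
degree-`6` fields `ℚ(ζ₇)`, `ℚ(ζ₉)`); here the degree-`10` field `ℚ(ζ₁₁)` (`d = −11⁹ = −2357947691`), the next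
entry of Masley–Montgomery's list (`h(ℚ(ζ_n)) = 1` iff `φ(n) ≤ 20` or `n ∈ {35, 45, 84}`; Washington Thm. 11.1).

The Minkowski constant is `M_K = (4/π)⁵ · (10!/10¹⁰) · √(11⁹) ≈ 58.96 < 59` (with `π > 3.141592`), so every
ideal class contains an ideal of norm `≤ 58`, and Mathlib's Galois-case criterion
`RingOfIntegers.isPrincipalIdealRing_of_isPrincipal_of_lt_or_isPrincipal_of_mem_primesOver_of_mem_Icc` asks, for
every prime `p ≤ 58`, for a prime of `𝓞_K` above `p` which has `p^f > 58` or is principal.  By Marcus' Theorem 26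
(`IsCyclotomicExtension.Rat.inertiaDeg_eq_of_not_dvd`: the residue degree of `p ∤ 11` is the order of `p` modulo
`11`) the primes `p ≤ 58`, `p ≠ 11, 23` have `p^f > 58` (`f = 10` for `p ≡ 2, 6, 7, 8`, `f = 5` for
`p ≡ 3, 4, 5, 9`, `f = 2` for `p = 43 ≡ −1 (mod 11)`); `11` is totally ramified with the principal prime
`(ζ − 1)` above it; and `23 ≡ 1 (mod 11)` SPLITS COMPLETELY (`f = 1`, norm `23 < 59`), so a principal prime
above `23` must be exhibited: **the element `1 + ζ + ζ³` of norm `23`**.  We certify this without computing a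
norm: the reduction map `φ : 𝓞_K = ℤ[ζ] → 𝔽₂₃`, `ζ ↦ 4` (`4` is a primitive `11`-th root of unity mod `23`;
`PowerBasis.lift` on Mathlib's integral power basis) has prime kernel `𝔓 = (23, ζ − 4)` lying over `23`, and
`𝔓 = (1 + ζ + ζ³)` because of the two identities in `ℤ[ζ]` (found by machine, checked by `linear_combination`
modulo `Φ₁₁(ζ) = 0`)
`(1 + ζ + ζ³)(−2 − 14ζ − 17ζ² − 12ζ³ − 5ζ⁴ − 9ζ⁵ − 10ζ⁶ − 16ζ⁷ − 6ζ⁸ − 15ζ⁹) = 23`,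
`(1 + ζ + ζ³)(1 + 3ζ + 3ζ² + 2ζ³ + ζ⁴ + 2ζ⁵ + 2ζ⁶ + 3ζ⁷ + ζ⁸ + 3ζ⁹) = ζ − 4`,
which put `23` and `ζ − 4` in `(1 + ζ + ζ³)`, while `φ(1 + ζ + ζ³) = 1 + 4 + 64 = 69 = 3 · 23 = 0`.

* `discr_of_isCyclotomicExtension_eleven` (`d = −2357947691`), `minkowskiBound_lt_of_isCyclotomicExtension_eleven`
  (`M_K < 59`), **`span_one_add_zeta_add_zeta_pow_three_mem_primesOver_eleven`** (`(1 + ζ + ζ³)` is a prime above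
  `23`), **`classNumber_eq_one_of_isCyclotomicExtension_eleven`** (`h(K) = 1` for every `11`-th cyclotomic
  extension `K/ℚ`), `isPrincipalIdealRing_adjoin_of_isPrimitiveRoot_eleven` (`ℤ[ζ₁₁]` is a PID),
  `isPrincipalIdealRing_ringOfIntegers_cyclotomicField_eleven`, `classNumber_cyclotomicField_eleven`.

Consumers: the lane's `ζ₁₁`-fivefolds (`Geometry/Kaehler/ComplexTorusCyclotomicAutomorphismSimplePrimeDimension`),
whose isomorphism classification needs `h(ℚ(ζ₁₁)) = 1`.

## References

* [Washington1997] L. C. Washington, *Introduction to Cyclotomic Fields*, 2nd ed., GTM 83 (1997), Thm. 11.1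
  (Masley–Montgomery), Prop. 2.7 (discriminant), §2 (splitting of primes).
* [Marcus2018] D. A. Marcus, *Number Fields*, 2nd ed. (2018), Ch. 3 Thm. 26 (chunk p0064), Ch. 5 Thm. 37 Cor. 2
  (p0107).
* [MasleyMontgomery1976] J. M. Masley, H. L. Montgomery, *Cyclotomic fields with unique factorization*, J. reine
  angew. Math. 286/287 (1976) 248–256.
-/

noncomputable section

namespace Literature.NumberTheory.NumberFields

open NumberField NumberField.InfinitePlace Polynomial Nat Real IsCyclotomicExtension.Rat Ideal
open scoped Real

section Eleven

variable (K : Type) [Field K] [NumberField K] [IsCyclotomicExtension {11} ℚ K]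

/-- **The discriminant of `ℚ(ζ₁₁)` is `−11⁹ = −2357947691`.** [cite: Washington1997, Prop. 2.7] [cite: Marcus2018, Ch. 2 (discriminant of the `p`-th cyclotomic field, `± p^{p−2}`)] -/
theorem discr_of_isCyclotomicExtension_eleven : NumberField.discr K = -2357947691 := by
  haveI : Fact (Nat.Prime 11) := ⟨Nat.prime_eleven⟩
  rw [discr_prime 11 K]
  norm_num

/-- **The Minkowski constant of `ℚ(ζ₁₁)` is `< 59`**: `(4/π)⁵ · (10!/10¹⁰) · √(11⁹) < (4/3.141592)⁵ · (567/1562500)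
· 48559 < 59` (the true value is `≈ 58.96`). [cite: Marcus2018, Ch. 5 Thm. 37 Cor. 2 (p0107)] -/
theorem minkowskiBound_lt_of_isCyclotomicExtension_eleven :
    (4 / π) ^ nrComplexPlaces K * ((Module.finrank ℚ K)! / (Module.finrank ℚ K) ^ (Module.finrank ℚ K) *
      √|(NumberField.discr K : ℝ)|) < 59 := by
  haveI : Fact (Nat.Prime 11) := ⟨Nat.prime_eleven⟩
  rw [discr_of_isCyclotomicExtension_eleven K, IsCyclotomicExtension.finrank (n := 11) K
    (cyclotomic.irreducible_rat (by norm_num)), nrComplexPlaces_eq_totient_div_two 11,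
    show Nat.totient 11 = 10 by decide]
  have hπ : 4 / π < 4 / 3.141592 := by
    apply div_lt_div_of_pos_left (by norm_num) (by norm_num) pi_gt_d6
  have hπ0 : 0 ≤ 4 / π := by positivity
  have h5 : (4 / π) ^ (10 / 2) < (4 / 3.141592 : ℝ) ^ (10 / 2) := by
    rw [show (10 / 2 : ℕ) = 5 by norm_num]
    gcongr
  have hsqrt : √|((-2357947691 : ℤ) : ℝ)| < 48559 := by
    rw [show |((-2357947691 : ℤ) : ℝ)| = 2357947691 by norm_num, Real.sqrt_lt' (by norm_num)]
    norm_num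
  have hfac : ((10 : ℕ)! : ℝ) / (10 : ℕ) ^ (10 : ℕ) = 567 / 1562500 := by
    rw [show (10 : ℕ)! = 3628800 by rfl]
    norm_num
  rw [hfac]
  calc (4 / π) ^ (10 / 2) * (567 / 1562500 * √|((-2357947691 : ℤ) : ℝ)|)
      ≤ (4 / 3.141592 : ℝ) ^ (10 / 2) * (567 / 1562500 * 48559) := by
        gcongr
    _ < 59 := by norm_num

variable {K} in
/-- **THE PRINCIPAL PRIME `(1 + ζ + ζ³)` OF `𝓞_{ℚ(ζ₁₁)}` ABOVE `23`**: for a primitive `11`-th root of unity `ζ`,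
the ideal `(1 + ζ + ζ³)` of `𝓞_K` is prime and lies over `23` — it is the kernel `(23, ζ − 4)` of the reduction
`ℤ[ζ] → 𝔽₂₃`, `ζ ↦ 4`, by the identities `(1 + ζ + ζ³)·β = 23`, `(1 + ζ + ζ³)·γ = ζ − 4` in `ℤ[ζ]` recorded in the
module docstring (so `N(1 + ζ + ζ³) = 23`: `23 ≡ 1 (mod 11)` splits completely). [cite: Marcus2018, Ch. 3 Thm. 26 (p0064) and Thm. 27]
[cite: Washington1997, §2 (splitting of primes in `ℚ(ζ_n)`)] -/
theorem span_one_add_zeta_add_zeta_pow_three_mem_primesOver_eleven {ζ : K} (hζ : IsPrimitiveRoot ζ 11) :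
    Ideal.span {1 + hζ.toInteger + hζ.toInteger ^ 3} ∈ primesOver (span {((23 : ℕ) : ℤ)}) (𝓞 K) := by
  -- arithmetic in `𝔽₂₃`, before any local `Fact` enters the context
  have hy0 : ((Finset.range 11).sum fun i ↦ (4 : ZMod 23) ^ i) = 0 := by decide
  have hα0 : (1 + 4 + 4 ^ 3 : ZMod 23) = 0 := by decide
  -- the reduction map `red : 𝓞 K → 𝔽₂₃`, `ζ ↦ 4`
  have hy : aeval (4 : ZMod 23) (minpoly ℤ hζ.integralPowerBasis.gen) = 0 := by
    haveI : Fact (Nat.Prime 11) := ⟨Nat.prime_eleven⟩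
    rw [hζ.integralPowerBasis_gen, ← NumberField.RingOfIntegers.minpoly_coe]
    change aeval (4 : ZMod 23) (minpoly ℤ ζ) = 0
    rw [← cyclotomic_eq_minpoly hζ (by norm_num), cyclotomic_prime, map_sum]
    simpa only [map_pow, aeval_X] using hy0
  set red : 𝓞 K →+* ZMod 23 := (hζ.integralPowerBasis.lift (4 : ZMod 23) hy).toRingHom with hred
  set z : 𝓞 K := hζ.toInteger with hz
  have hφz : red z = 4 := by
    rw [hred, hz, ← hζ.integralPowerBasis_gen]
    exact hζ.integralPowerBasis.lift_gen 4 hy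
  -- `Φ₁₁(ζ) = 0` in `𝓞 K`
  have hΦ : 1 + z + z ^ 2 + z ^ 3 + z ^ 4 + z ^ 5 + z ^ 6 + z ^ 7 + z ^ 8 + z ^ 9 + z ^ 10 = 0 := by
    have h := hζ.toInteger_isPrimitiveRoot.geom_sum_eq_zero (by norm_num : 1 < 11)
    rw [← hz] at h
    simpa [Finset.sum_range_succ] using h
  -- the two certificates
  have h23 : (1 + z + z ^ 3) * (-2 - 14 * z - 17 * z ^ 2 - 12 * z ^ 3 - 5 * z ^ 4 - 9 * z ^ 5 - 10 * z ^ 6 -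
      16 * z ^ 7 - 6 * z ^ 8 - 15 * z ^ 9) = 23 := by
    linear_combination (-25 + 9 * z - 15 * z ^ 2) * hΦ
  have h4 : (1 + z + z ^ 3) * (1 + 3 * z + 3 * z ^ 2 + 2 * z ^ 3 + z ^ 4 + 2 * z ^ 5 + 2 * z ^ 6 + 3 * z ^ 7 +
      z ^ 8 + 3 * z ^ 9) = z - 4 := by
    linear_combination (5 - 2 * z + 3 * z ^ 2) * hΦ
  -- `ker red = (1 + ζ + ζ³)`
  have hφα : red (1 + z + z ^ 3) = 0 := by
    rw [map_add, map_add, map_one, map_pow, hφz]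
    exact hα0
  have hker : RingHom.ker red = Ideal.span {1 + z + z ^ 3} := by
    apply le_antisymm
    · intro x hx
      rw [RingHom.mem_ker] at hx
      obtain ⟨g, hg⟩ := hζ.integralPowerBasis.exists_eq_aeval' x
      rw [hζ.integralPowerBasis_gen, ← hz] at hg
      have hdec := modByMonic_add_div g (X - C (4 : ℤ))
      rw [modByMonic_X_sub_C_eq_C_eval] at hdec
      have hx' : x = ((g.eval 4 : ℤ) : 𝓞 K) + (z - 4) * aeval z (g /ₘ (X - C 4)) := by
        rw [hg]
        conv_lhs => rw [← hdec]
        simp only [map_add, map_mul, map_sub, map_intCast, map_ofNat, aeval_X, eq_intCast]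
      have hc : ((g.eval 4 : ℤ) : ZMod 23) = 0 := by
        have h := hx
        rw [hx', map_add, map_mul, map_sub, map_intCast, hφz, map_ofNat, sub_self, zero_mul, add_zero] at h
        exact h
      obtain ⟨m, hm⟩ := (ZMod.intCast_zmod_eq_zero_iff_dvd _ 23).1 hc
      rw [hx', hm, Int.cast_mul, Int.cast_natCast]
      refine Ideal.add_mem _ ?_ ?_
      · rw [show ((23 : ℕ) : 𝓞 K) = 23 from rfl, ← h23, mul_assoc]
        exact Ideal.mul_mem_right _ _ (Ideal.subset_span rfl)
      · rw [← h4, mul_assoc]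
        exact Ideal.mul_mem_right _ _ (Ideal.subset_span rfl)
    · rw [Ideal.span_le, Set.singleton_subset_iff]
      exact hφα
  -- conclusion: `ker red` is prime (`𝔽₂₃` is a domain) and lies over `ker (ℤ → 𝔽₂₃) = (23)`
  haveI : Fact (Nat.Prime 23) := ⟨by norm_num⟩
  rw [← hker]
  refine ⟨RingHom.ker_isPrime red, ⟨?_⟩⟩
  rw [Ideal.under_def, RingHom.comap_ker, RingHom.ext_int (red.comp (algebraMap ℤ (𝓞 K))) (Int.castRingHom (ZMod 23)),
    ZMod.ker_intCastRingHom]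

/-- `𝓞_K` is a principal ideal domain for an `11`-th cyclotomic extension `K/ℚ` (the Minkowski-bound argument; public
form: `classNumber_eq_one_of_isCyclotomicExtension_eleven`). [cite: Marcus2018, Ch. 5 Thm. 37 Cor. 2 (p0107)]
[cite: Washington1997, Thm. 11.1] -/
private theorem isPrincipalIdealRing_ringOfIntegers_eleven_aux : IsPrincipalIdealRing (𝓞 K) := by
  -- Thm. 26 data: the orders of the primes `≤ 58`, `≠ 11, 23`, modulo `11`
  -- (stated before any `Fact (Nat.Prime _)` enters the context, so that `decide` sees closed terms)
  have o2 : orderOf (2 : ZMod 11) = 10 :=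
    (orderOf_eq_iff (by norm_num)).2 ⟨by decide, fun m hm h0 ↦ by interval_cases m <;> decide⟩
  have o3 : orderOf (3 : ZMod 11) = 5 :=
    (orderOf_eq_iff (by norm_num)).2 ⟨by decide, fun m hm h0 ↦ by interval_cases m <;> decide⟩
  have o5 : orderOf (5 : ZMod 11) = 5 :=
    (orderOf_eq_iff (by norm_num)).2 ⟨by decide, fun m hm h0 ↦ by interval_cases m <;> decide⟩
  have o7 : orderOf (7 : ZMod 11) = 10 :=
    (orderOf_eq_iff (by norm_num)).2 ⟨by decide, fun m hm h0 ↦ by interval_cases m <;> decide⟩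
  have o13 : orderOf (13 : ZMod 11) = 10 :=
    (orderOf_eq_iff (by norm_num)).2 ⟨by decide, fun m hm h0 ↦ by interval_cases m <;> decide⟩
  have o17 : orderOf (17 : ZMod 11) = 10 :=
    (orderOf_eq_iff (by norm_num)).2 ⟨by decide, fun m hm h0 ↦ by interval_cases m <;> decide⟩
  have o19 : orderOf (19 : ZMod 11) = 10 :=
    (orderOf_eq_iff (by norm_num)).2 ⟨by decide, fun m hm h0 ↦ by interval_cases m <;> decide⟩
  have o29 : orderOf (29 : ZMod 11) = 10 :=
    (orderOf_eq_iff (by norm_num)).2 ⟨by decide, fun m hm h0 ↦ by interval_cases m <;> decide⟩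
  have o31 : orderOf (31 : ZMod 11) = 5 :=
    (orderOf_eq_iff (by norm_num)).2 ⟨by decide, fun m hm h0 ↦ by interval_cases m <;> decide⟩
  have o37 : orderOf (37 : ZMod 11) = 5 :=
    (orderOf_eq_iff (by norm_num)).2 ⟨by decide, fun m hm h0 ↦ by interval_cases m <;> decide⟩
  have o41 : orderOf (41 : ZMod 11) = 10 :=
    (orderOf_eq_iff (by norm_num)).2 ⟨by decide, fun m hm h0 ↦ by interval_cases m <;> decide⟩
  have o43 : orderOf (43 : ZMod 11) = 2 :=
    (orderOf_eq_iff (by norm_num)).2 ⟨by decide, fun m hm h0 ↦ by interval_cases m; decide⟩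
  have o47 : orderOf (47 : ZMod 11) = 5 :=
    (orderOf_eq_iff (by norm_num)).2 ⟨by decide, fun m hm h0 ↦ by interval_cases m <;> decide⟩
  have o53 : orderOf (53 : ZMod 11) = 5 :=
    (orderOf_eq_iff (by norm_num)).2 ⟨by decide, fun m hm h0 ↦ by interval_cases m <;> decide⟩
  haveI : Fact (Nat.Prime 11) := ⟨Nat.prime_eleven⟩
  haveI : IsGalois ℚ K := IsCyclotomicExtension.isGalois {11} ℚ K
  have hM := minkowskiBound_lt_of_isCyclotomicExtension_eleven K
  have hfloor : ⌊(4 / π) ^ nrComplexPlaces K * ((Module.finrank ℚ K)! / (Module.finrank ℚ K) ^ (Module.finrank ℚ K) *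
      √|(NumberField.discr K : ℝ)|)⌋₊ ≤ 58 :=
    Nat.le_of_lt_succ ((Nat.floor_lt (by positivity)).2 hM)
  -- the unramified primes: `p^f > 58` with `f` the order of `p` modulo `11`
  have key : ∀ p : ℕ, p.Prime → ¬ p ∣ 11 →
      ⌊(4 / π) ^ nrComplexPlaces K * ((Module.finrank ℚ K)! / (Module.finrank ℚ K) ^ (Module.finrank ℚ K) *
        √|(NumberField.discr K : ℝ)|)⌋₊ < p ^ orderOf (p : ZMod 11) →
      ∃ P ∈ primesOver (span {(p : ℤ)}) (𝓞 K),
        ⌊(4 / π) ^ nrComplexPlaces K * ((Module.finrank ℚ K)! / (Module.finrank ℚ K) ^ (Module.finrank ℚ K) *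
          √|(NumberField.discr K : ℝ)|)⌋₊ < p ^ P.inertiaDeg ℤ ∨ Submodule.IsPrincipal P := by
    intro p hp hdvd hlt
    haveI : Fact p.Prime := ⟨hp⟩
    obtain ⟨⟨P, hP⟩⟩ := (Ideal.span {(p : ℤ)}).nonempty_primesOver (S := 𝓞 K)
    refine ⟨P, hP, Or.inl ?_⟩
    haveI := hP.1
    haveI := hP.2
    rwa [inertiaDeg_eq_of_not_dvd p K P (m := 11) hdvd]
  apply RingOfIntegers.isPrincipalIdealRing_of_isPrincipal_of_lt_or_isPrincipal_of_mem_primesOver_of_mem_Icc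
  intro p hp hpp
  have hp58 : p ≤ 58 := (Finset.mem_Icc.1 hp).2.trans hfloor
  have hp2 : 2 ≤ p := hpp.two_le
  interval_cases p
  · exact key 2 hpp (by norm_num) (by rw [Nat.cast_ofNat, o2]; omega)
  · exact key 3 hpp (by norm_num) (by rw [Nat.cast_ofNat, o3]; omega)
  · norm_num at hpp -- `4` is not prime
  · exact key 5 hpp (by norm_num) (by rw [Nat.cast_ofNat, o5]; omega)
  · norm_num at hpp -- `6` is not prime
  · exact key 7 hpp (by norm_num) (by rw [Nat.cast_ofNat, o7]; omega)
  · norm_num at hpp -- `8` is not prime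
  · norm_num at hpp -- `9` is not prime
  · norm_num at hpp -- `10` is not prime
  · -- `p = 11`: the prime above `11` is `(ζ − 1)`, principal
    haveI : IsCyclotomicExtension {11 ^ (0 + 1)} ℚ K := by simpa using (inferInstance : IsCyclotomicExtension {11} ℚ K)
    have hζ := IsCyclotomicExtension.zeta_spec (11 ^ (0 + 1)) ℚ K
    refine ⟨Ideal.span {hζ.toInteger - 1}, ⟨inferInstance, ?_⟩, Or.inr ⟨hζ.toInteger - 1, rfl⟩⟩
    have h := liesOver_span_zeta_sub_one 11 0 hζ
    simpa using h
  · norm_num at hpp -- `12` is not prime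
  · exact key 13 hpp (by norm_num) (by rw [Nat.cast_ofNat, o13]; omega)
  · norm_num at hpp -- `14` is not prime
  · norm_num at hpp -- `15` is not prime
  · norm_num at hpp -- `16` is not prime
  · exact key 17 hpp (by norm_num) (by rw [Nat.cast_ofNat, o17]; omega)
  · norm_num at hpp -- `18` is not prime
  · exact key 19 hpp (by norm_num) (by rw [Nat.cast_ofNat, o19]; omega)
  · norm_num at hpp -- `20` is not prime
  · norm_num at hpp -- `21` is not prime
  · norm_num at hpp -- `22` is not prime
  · -- `p = 23`: splits completely; the prime `(1 + ζ + ζ³)` above it is principal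
    have hζ := IsCyclotomicExtension.zeta_spec 11 ℚ K
    exact ⟨_, span_one_add_zeta_add_zeta_pow_three_mem_primesOver_eleven hζ, Or.inr ⟨_, rfl⟩⟩
  · norm_num at hpp -- `24` is not prime
  · norm_num at hpp -- `25` is not prime
  · norm_num at hpp -- `26` is not prime
  · norm_num at hpp -- `27` is not prime
  · norm_num at hpp -- `28` is not prime
  · exact key 29 hpp (by norm_num) (by rw [Nat.cast_ofNat, o29]; omega)
  · norm_num at hpp -- `30` is not prime
  · exact key 31 hpp (by norm_num) (by rw [Nat.cast_ofNat, o31]; omega)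
  · norm_num at hpp -- `32` is not prime
  · norm_num at hpp -- `33` is not prime
  · norm_num at hpp -- `34` is not prime
  · norm_num at hpp -- `35` is not prime
  · norm_num at hpp -- `36` is not prime
  · exact key 37 hpp (by norm_num) (by rw [Nat.cast_ofNat, o37]; omega)
  · norm_num at hpp -- `38` is not prime
  · norm_num at hpp -- `39` is not prime
  · norm_num at hpp -- `40` is not prime
  · exact key 41 hpp (by norm_num) (by rw [Nat.cast_ofNat, o41]; omega)
  · norm_num at hpp -- `42` is not prime
  · exact key 43 hpp (by norm_num) (by rw [Nat.cast_ofNat, o43]; omega)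
  · norm_num at hpp -- `44` is not prime
  · norm_num at hpp -- `45` is not prime
  · norm_num at hpp -- `46` is not prime
  · exact key 47 hpp (by norm_num) (by rw [Nat.cast_ofNat, o47]; omega)
  · norm_num at hpp -- `48` is not prime
  · norm_num at hpp -- `49` is not prime
  · norm_num at hpp -- `50` is not prime
  · norm_num at hpp -- `51` is not prime
  · norm_num at hpp -- `52` is not prime
  · exact key 53 hpp (by norm_num) (by rw [Nat.cast_ofNat, o53]; omega)
  · norm_num at hpp -- `54` is not prime
  · norm_num at hpp -- `55` is not prime
  · norm_num at hpp -- `56` is not prime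
  · norm_num at hpp -- `57` is not prime
  · norm_num at hpp -- `58` is not prime

end Eleven

/-! ### Class number one, for an arbitrary model `K`, and for Mathlib's `CyclotomicField 11 ℚ` -/

/-- **EVERY `11`-TH CYCLOTOMIC EXTENSION `K/ℚ` HAS CLASS NUMBER ONE** (`𝓞_K = ℤ[ζ₁₁]` is a principal ideal
domain): Minkowski's bound `M_K < 59`, Marcus' Theorem 26 for the primes `p ≤ 58`, `p ≠ 11, 23`, the principal
ramified prime `(ζ − 1)`, and the principal prime `(1 + ζ + ζ³)` above the completely split `23`.  (The
instance `IsPrincipalIdealRing (𝓞 K)` is `(NumberField.classNumber_eq_one_iff).1` of this.)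
[cite: Washington1997, Thm. 11.1] [cite: Marcus2018, Ch. 5 Thm. 37 Cor. 2 (p0107) and Ch. 3 Thm. 26 (p0064)]
[cite: MasleyMontgomery1976, Main Theorem] -/
theorem classNumber_eq_one_of_isCyclotomicExtension_eleven (K : Type) [Field K] [NumberField K]
    (hK : IsCyclotomicExtension {11} ℚ K) : classNumber K = 1 :=
  (classNumber_eq_one_iff (K := K)).2 (isPrincipalIdealRing_ringOfIntegers_eleven_aux K)

/-- **`ℤ[ζ₁₁]` IS A PRINCIPAL IDEAL DOMAIN**: for every primitive `11`-th root of unity `ζ` of an `11`-th cyclotomic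
extension `K/ℚ`, the order `ℤ[ζ]` (`= 𝓞_K`, Mathlib `IsPrimitiveRoot.adjoinEquivRingOfIntegers`) is a principal ideal
ring. [cite: Washington1997, Thm. 11.1] [cite: MasleyMontgomery1976, Main Theorem] -/
theorem isPrincipalIdealRing_adjoin_of_isPrimitiveRoot_eleven {K : Type} [Field K] [NumberField K]
    [IsCyclotomicExtension {11} ℚ K] {ζ : K} (hζ : IsPrimitiveRoot ζ 11) :
    IsPrincipalIdealRing (Algebra.adjoin ℤ ({ζ} : Set K)) :=
  haveI := isPrincipalIdealRing_ringOfIntegers_eleven_aux K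
  IsPrincipalIdealRing.of_surjective hζ.adjoinEquivRingOfIntegers.symm hζ.adjoinEquivRingOfIntegers.symm.surjective

/-- `CyclotomicField 11 ℚ` is an `11`-th cyclotomic extension of `ℚ` (Mathlib instance, as a term). [folklore] -/
private theorem isCyclotomicExtension_cyclotomicField_eleven :
    IsCyclotomicExtension {11} ℚ (CyclotomicField 11 ℚ) :=
  CyclotomicField.isCyclotomicExtension 11 ℚ

/-- **The ring of integers of `CyclotomicField 11 ℚ` (`= ℤ[ζ₁₁]`) is a principal ideal domain.**
[cite: Washington1997, Thm. 11.1] [cite: MasleyMontgomery1976, Main Theorem] -/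
theorem isPrincipalIdealRing_ringOfIntegers_cyclotomicField_eleven :
    IsPrincipalIdealRing (𝓞 (CyclotomicField 11 ℚ)) :=
  haveI := isCyclotomicExtension_cyclotomicField_eleven
  isPrincipalIdealRing_ringOfIntegers_eleven_aux (CyclotomicField 11 ℚ)

/-- **`h(ℚ(ζ₁₁)) = 1`.** [cite: Washington1997, Thm. 11.1] [cite: MasleyMontgomery1976, Main Theorem] -/
theorem classNumber_cyclotomicField_eleven : classNumber (CyclotomicField 11 ℚ) = 1 :=
  (classNumber_eq_one_iff (K := CyclotomicField 11 ℚ)).2 isPrincipalIdealRing_ringOfIntegers_cyclotomicField_eleven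

end Literature.NumberTheory.NumberFields

end
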